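import Summits.AtomisticToContinuum.HydrodynamicLimit.Theses.InformationPercolationEngine
import Summits.AtomisticToContinuum.HydrodynamicLimit.Theorems.KickIsotropyInfo.Negative.KickIsotropyInfoFalseOfShieldingBiasPersists

/-!
# Assembly of route InformationPercolationEngine (stmt-AtomisticToContinuum-13918)

The assembly item of route `route-AtomisticToContinuum-InformationPercolationEngine` (rev 3) is the curried
implication

`KickIsotropyInfo → SpectralContractionR → PercolationClosesChaos → CollisionRate → LocalSecondLaw → DensityCap →
HsEosLowDensity → DiluteSelfConsistency → KineticClosure → HydrodynamicLimit`.

It is pure logic: `PercolationClosesChaos` is by definition `KickIsotropyInfo → SpectralContractionR → ContactChaos`,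
and `KineticClosure` is by definition `ContactChaos → CollisionRate → LocalSecondLaw → DensityCap → (hs EOS fact) →
(dilute self-consistency) → HydrodynamicLimit`, with the last two hypotheses the verbatim bodies of `HsEosLowDensity`
and `DiluteSelfConsistency`. The route's certified deciding theorem `closes` has exactly this type, so the assembly
is the term of `closes`, written out so that the file does not depend on the argument order of `closes`.
prover-pitem-stmt-AtomisticToContinuum-13918-0.

Maintenance note (fullbuild repair 2026-08-17; no mathematics added or changed). The paragraph above describes
rev 3 of the route (2026-08-16T04:46Z). Since then the route was edited to rev 16: the crux `KickIsotropyInfo`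
(stmt-13478) was retired at rev 5, the support `KineticClosure` (stmt-13482) dropped at rev 9 (closed `moot`), the
engine crux `PercolationClosesChaos` restated over the successor mechanism crux (now
`KickFairRelEquilibriumMeso → SpectralContractionR → ContactChaos`), the sub-problem conjunct `HydrodynamicLimit`
re-typed (p126922, packing-guarded), and the item `Assembly` restated five times (stmt-13918 → 14916 → 15140 →
15179 → 17601 → 17869; the live `Theses.InformationPercolationEngine.Assembly` is the five-antecedent rev-16 frame,
served by `InformationPercolationEngineAssemblyReduction.lean`). The ledger records stmt-13918 as proved by
`Theorems.Assembly_proof` @ d40345d45b7c; for this append-only file to keep elaborating, the three retired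
statements it is about are recorded below under Theorems-local names with their LEDGER SIGNATURES VERBATIM
(`InformationPercolationEnginePercolationClosesChaosRev3` = stmt-13914, `InformationPercolationEngineKineticClosureRev3`
= stmt-13482, `InformationPercolationEngineAssemblyRev3` = stmt-13918), elaborated against the live declarations of
the names they mention (`SpectralContractionR`, `ContactChaos`, `CollisionRate`, `LocalSecondLaw`, `DensityCap`,
`HsEosLowDensity`, `DiluteSelfConsistency` of the route file; the registry conjunct `_root_.HydrodynamicLimit`; and
`KickIsotropyInfo` as already re-homed verbatim in
`Theorems/KickIsotropyInfo/Negative/KickIsotropyInfoFalseOfShieldingBiasPersists.lean`, shared rather than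
re-declared), the proof keeps its text with the recorded statement as its type under the new name
`informationPercolationEngine_assembly_rev3_proof`, and `Assembly_proof` survives as its deprecated alias — the same
device as `Theorems/CollisionIsometryCLTAdaptedWeightCLTStatements.lean` (`AdaptedWeightCLTRev11`, `adaptedWeightCLT_iff`). Nothing is
asserted: the three records are `Prop` definitions, used only as the subject of the bookkeeping lemma.
-/

namespace Summit.AtomisticToContinuum.HydrodynamicLimit.Theorems

open Summit.AtomisticToContinuum.HydrodynamicLimit.Theses.InformationPercolationEngine
  (SpectralContractionR ContactChaos CollisionRate LocalSecondLaw DensityCap HsEosLowDensity DiluteSelfConsistency)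
open Summit.AtomisticToContinuum.HydrodynamicLimit.Theorems.KickIsotropyInfoNegative (KickIsotropyInfo)

/-- **Record of the retired engine crux `PercolationClosesChaos`, rev 3** (stmt-AtomisticToContinuum-13914, closed
`retired` at route rev 5; ledger signature verbatim): admissible-kick isotropy and the spectral contraction of the
linearised hard-sphere gain operator close averaged molecular chaos at contact —
`KickIsotropyInfo → SpectralContractionR → ContactChaos`. The live route decl of the same name is stated over the
successor mechanism crux `KickFairRelEquilibriumMeso`; this record exists only as an antecedent of
`InformationPercolationEngineAssemblyRev3`. A `Prop`, never asserted. -/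
def InformationPercolationEnginePercolationClosesChaosRev3 : Prop :=
  KickIsotropyInfo → SpectralContractionR → ContactChaos

/-- **Record of the dropped support `KineticClosure`** (stmt-AtomisticToContinuum-13482, dropped at route rev 9 and
closed `moot` after four prover verdicts "not closable as filed — no velocity-tail control"; replaced by the dock crux
`ChaosClosesEuler`, stmt-15141; ledger signature verbatim, its final `HydrodynamicLimit` being the registry conjunct
`_root_.HydrodynamicLimit` as the route file renders it): chaos at contact, the Enskog collision rate, the local
second law and the density cap, together with the hard-sphere equation of state at low density (fifth antecedent =
the body of `HsEosLowDensity`) and dilute self-consistency (sixth antecedent = the body of `DiluteSelfConsistency`),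
imply the hydrodynamic limit. This record exists only as an antecedent of `InformationPercolationEngineAssemblyRev3`.
A `Prop`, never asserted. -/
def InformationPercolationEngineKineticClosureRev3 : Prop :=
  ContactChaos → CollisionRate → LocalSecondLaw → DensityCap → (∃ η₀ : ℝ, 0 < η₀ ∧ ∃ F : ℝ → ℝ, AnalyticOnNhd ℝ F (Set.Ioo (-η₀) η₀) ∧ Set.EqOn Literature.MathematicalPhysics.KineticTheory.hsExcessFreeEnergy F (Set.Ico 0 η₀) ∧ F 0 = 0 ∧ deriv F 0 = 2 * Real.pi / 3 ∧ ∀ η ∈ Set.Ico 0 η₀, Filter.Tendsto (fun N : ℕ => -(N : ℝ)⁻¹ * Real.log (Literature.MathematicalPhysics.KineticTheory.hsFreeVolume η N)) Filter.atTop (nhds (F η))) → (∀ η : ℝ, 0 < η → ∀ (a₀ θ₀ : Literature.MathematicalPhysics.KineticTheory.T3 → ℝ) (u₀ : Literature.MathematicalPhysics.KineticTheory.T3 → Literature.MathematicalPhysics.KineticTheory.V3), Continuous a₀ → Continuous θ₀ → Continuous u₀ → (∀ x, 0 < a₀ x) → (∀ x, 0 < θ₀ x) → ∃ σ₀ : ℝ,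 0 < σ₀ ∧ ∀ σ : ℝ, 0 < σ → σ < σ₀ → ∀ (T : ℝ) (ρ θ : ℝ → Literature.MathematicalPhysics.KineticTheory.T3 → ℝ) (u : ℝ → Literature.MathematicalPhysics.KineticTheory.T3 → Literature.MathematicalPhysics.KineticTheory.V3), Literature.MathematicalPhysics.KineticTheory.IsHardSphereEulerSolution σ T ρ u θ → ∀ Φ : (N : ℕ) → Literature.Analysis.FluidPDE.HardSphereFlow (Literature.Analysis.FluidPDE.Torus.geometry (Fin 3)) (Literature.MathematicalPhysics.KineticTheory.hsDiameter σ N) (N + 1), Literature.MathematicalPhysics.KineticTheory.TendstoHydroFieldsAt (fun N => Literature.MathematicalPhysics.KineticTheory.localGibbsLaw σ a₀ u₀ θ₀ N (Φ N)) Φ ρ u θ 0 → ∀ t ∈ Set.Ico 0 T, ∀ x, ρ t x * σ ^ 3 < η) → _root_.HydrodynamicLimit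

/-- **Record of the assembly item of route InformationPercolationEngine, rev 3** (stmt-AtomisticToContinuum-13918,
ledger signature verbatim; proved as `Theorems.Assembly_proof` @ d40345d45b7c — below:
`informationPercolationEngine_assembly_rev3_proof`, alias `Assembly_proof` — then superseded by the restatements
stmt-14916 → 15140 → 15179 → 17601 → 17869): the nine rev-3 route items imply `HydrodynamicLimit` —
`KickIsotropyInfo → SpectralContractionR → PercolationClosesChaos → CollisionRate → LocalSecondLaw → DensityCap →
HsEosLowDensity → DiluteSelfConsistency → KineticClosure → HydrodynamicLimit`, with `PercolationClosesChaos` and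
`KineticClosure` the rev-3 records above and `HydrodynamicLimit` the registry conjunct. A `Prop`, asserted only
through its proof `informationPercolationEngine_assembly_rev3_proof` (pure logic). -/
def InformationPercolationEngineAssemblyRev3 : Prop :=
  KickIsotropyInfo → SpectralContractionR → InformationPercolationEnginePercolationClosesChaosRev3 → CollisionRate →
    LocalSecondLaw → DensityCap → HsEosLowDensity → DiluteSelfConsistency →
      InformationPercolationEngineKineticClosureRev3 → _root_.HydrodynamicLimit

/-- **Assembly of route InformationPercolationEngine, rev 3** (stmt-AtomisticToContinuum-13918): the nine rev-3 route
items imply `HydrodynamicLimit`. Proof: apply `PercolationClosesChaos` to `KickIsotropyInfo` and `SpectralContractionR` to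
get `ContactChaos`, then feed it with the five closure supports to `KineticClosure` (definitional unfolding only; this was
the route's rev-3 deciding theorem `closes`). The proof text of the recorded `Assembly_proof` @ d40345d45b7c, unchanged,
against the verbatim record `InformationPercolationEngineAssemblyRev3` of the item's signature (fullbuild repair
2026-08-17: the live route decl `Assembly` is the rev-16 frame, for which the nine-binder `intro` fails). -/
theorem informationPercolationEngine_assembly_rev3_proof : InformationPercolationEngineAssemblyRev3 := by
  unfold InformationPercolationEngineAssemblyRev3
  intro hK hS hP hR hL hD hE hDS hKC
  exact hKC (hP hK hS) hR hL hD hE hDS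

/-- Deprecated spelling of `informationPercolationEngine_assembly_rev3_proof`: the ledger's closing declaration of
stmt-AtomisticToContinuum-13918 (`Theorems.Assembly_proof` @ d40345d45b7c) read
`theorem Assembly_proof : Theses.InformationPercolationEngine.Assembly` against the rev-3 item; since route rev 16
that decl name carries the five-antecedent open frame stmt-17869, which this bookkeeping does not prove, so the name
now points at the same proof of the verbatim record of the statement it was about (append-only: deprecate, don't
mutate). -/
@[deprecated informationPercolationEngine_assembly_rev3_proof (since := "2026-08-17")]
alias Assembly_proof := informationPercolationEngine_assembly_rev3_proof

end Summit.AtomisticToContinuum.HydrodynamicLimit.Theorems
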